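import Literature.Barriers.CriticalPhenomena.RigorousRGSmallParameterCovarianceDecomposition
import Literature.Barriers.CriticalPhenomena.RigorousRGSmallParameterFRDGradientScaleBounds
import HarnessLib

/-!
# `RigorousRGSmallParameter` (Slade, Theorem 1.4.1): the finite-range covariance estimate (3.9)
# with discrete gradients `∇^a` (Proposition 3.3.1 / 10.1.1, on `ℤ^d`)

Companion of `RigorousRGSmallParameterCovarianceBound.lean` (the case `a = 0`:
`FRD.Slade2017_prop331_estimate`) and `RigorousRGSmallParameterFRDGradientScaleBounds.lean`
((10.7)–(10.8) for `∇^a w`) in the proof architecture of the barrier `RigorousRGSmallParameter.lean`.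
Source: G. Slade, *Critical exponents for long-range `O(n)` models below the upper critical
dimension*, Commun. Math. Phys. 358 (2018) 343–436, Proposition 3.3.1: "let `a` be a multi-index
with `|a| ≤ ā` … (3.9) `|∇^aC_{j;x,y}| ≤ cL^{-(d-α+|a|)(j-1)} (1/(1+m⁴L^{2α(j-1)}))`, where `∇^a`
can act on either `x` or `y` or both", in the sharpened form (10.3) of Proposition 10.1.1
(`+ 1/(1+m²L^{p'(j-1)})`), and its proof in §10.1 (displays (10.6)–(10.18)), which is written for
general `a` throughout ("`|∇^a w(t,x;s)| ≤ c₀ (1/(1+s))(1+st²/(1+s))^{-p}(t² ∧ t^{-(d-2+|a|)})`").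
Here `C_{j;x,y} = C_j(x-y)` is translation invariant, so gradients in `x` and in `y` are both
gradients of `z ↦ C_j(z)` (up to sign and reflection of the steps); the statement is given for
`∇^l_z C_j(z)` with an arbitrary list `l` of unit steps.

## What this file proves (everything; no definition and no named fact is introduced)

* `FRD.latGrad_Gam_eq_regular_add` — (10.6) differentiated: `∇^lΓ_j = ∫_{J_j}∇^lw dt/t +
  𝟙_{j=1}∫_{(0,½]}∇^lw dt/t`.
* `FRD.abs_regular_grad_le_of_small_mass`, `FRD.abs_regular_grad_le_of_large_mass`,
  `FRD.abs_special_grad_le` — the regular and special parts with gradients.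
* **`FRD.Slade2017_prop331_grad_estimate_abs`** — **(3.9) = (10.3) with `∇^a`, PROVED** with the
  absolute value inside the `s`-integral: `∫₀^∞|∇^lΓ_j(x)(s)|ρ^{(α/2)}(s,m²)ds ≤
  c (L^{j-1})^{α-d-n}(1/(1+m⁴(L^{j-1})^{2α}) + 1/(1+m²(L^{j-1})^{p'}))` (`m² ≥ 0`).
* **`FRD.Slade2017_prop331_grad_estimate`** — the printed form `|∇^lC_{j;0,x}(m²)| ≤ …`
  (`m² > 0`).
* `FRD.continuous_latGrad_fracCov_mass` — `∇^l_xC_{j;0,x}(m²)` is continuous in `m²`.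
-/

noncomputable section

namespace Literature.Barriers.CriticalPhenomena

open _root_.MeasureTheory Set Filter
open scoped _root_.Topology Real FourierTransform

namespace LongRangePhi4

namespace FRD

open Literature.Probability.LatticeModels

variable {d : ℕ}

/-- **Slade (10.6), differentiated**: `∇^lΓ_j(x)(s) = ∫_{J_j}∇^l w(t,x;s)dt/t + 𝟙_{j=1}∫_{(0,½]}∇^l w(t,x;s)dt/t`,
`J_j = (½L^{j-1}, ½L^j]` (`L ≥ 1`, `s > 0`, `j ≥ 1`). [cite: Slade2017, §10.1 (display (10.6))] -/
theorem latGrad_Gam_eq_regular_add {L : ℝ} (hL : 1 ≤ L) {s : ℝ} (hs : 0 < s) {j : ℕ} (hj : 1 ≤ j)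
    (l : List (Site d)) (x : Site d) :
    latGrad l (Gam d L s j) x =
      (∫ t in Ioc (L ^ (j - 1) / 2) (L ^ (j - 1) * L / 2), latGrad l (wKer d s t) x / t) +
      (if j = 1 then ∫ t in Ioc 0 (1 / 2), latGrad l (wKer d s t) x / t else 0) := by
  rcases Nat.lt_or_ge j 2 with hj1 | hj2
  · have hj' : j = 1 := by omega
    subst hj'
    rw [if_pos rfl, latGrad_Gam_one (b := 1 / 2) (by norm_num) (by linarith) hs l x]
    simp
  · rw [if_neg (by omega), add_zero, latGrad_Gam (by linarith) hs hj2 l x]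
    have hLj : L ^ j / 2 = L ^ (j - 1) * L / 2 := by
      rw [← pow_succ, Nat.sub_add_cancel hj]
    rw [hLj]

/-- **The regular part in the small-mass regime, with gradients**: if
`|∇^l w(t,x;s)| ≤ c(1+st²)^{-p}t^{2-d-n}` for `t ≥ ½`, `s ≤ 1` (Slade (10.8), second regime),
then for `ℓ ≥ 1`, `L ≥ 1`, `0 < s ≤ 1`:
`|∫_{(½ℓ,½ℓL]} ∇^l w(t,x;s)dt/t| ≤ c ℓ^{2-d-n} ∫_{(½,½L]} (1+sℓ²τ²)^{-p}τ^{2-d-n} dτ/τ`.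
[cite: Slade2017, §10.1 (displays (10.15)–(10.17): T_{j,1}, T_{j,2}, with ∇^a)] -/
theorem abs_regular_grad_le_of_small_mass {c : ℝ} {p n : ℕ} {l : List (Site d)}
    (hw : ∀ s : ℝ, 0 < s → s ≤ 1 → ∀ t : ℝ, 1 / 2 ≤ t → ∀ x : Site d,
      |latGrad l (wKer d s t) x| ≤ c * ((1 + s * t ^ 2) ^ p)⁻¹ * (t ^ 2 / t ^ (d + n)))
    {L : ℝ} (hL : 1 ≤ L) {ℓ : ℝ} (hℓ : 1 ≤ ℓ) {s : ℝ} (hs : 0 < s) (hs1 : s ≤ 1) (x : Site d) :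
    |∫ t in Ioc (ℓ / 2) (ℓ * L / 2), latGrad l (wKer d s t) x / t| ≤
      c * (ℓ ^ 2 / ℓ ^ (d + n)) *
        ∫ τ in Ioc (1 / 2 : ℝ) (L / 2), ((1 + s * ℓ ^ 2 * τ ^ 2) ^ p)⁻¹ * (τ ^ 2 / τ ^ (d + n)) / τ := by
  have hℓ0 : 0 < ℓ := by linarith
  set F : ℝ → ℝ := fun t => c * ((1 + s * t ^ 2) ^ p)⁻¹ * (t ^ 2 / t ^ (d + n)) / t with hF
  have hFcont : ∀ a b : ℝ, 0 < a → ContinuousOn F (Icc a b) := by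
    intro a b ha
    have hne : ∀ t ∈ Icc a b, t ≠ 0 := fun t ht => (lt_of_lt_of_le ha ht.1).ne'
    have hne' : ∀ t ∈ Icc a b, t ^ (d + n) ≠ 0 := fun t ht => pow_ne_zero (d + n) (hne t ht)
    have hne'' : ∀ t ∈ Icc a b, (1 + s * t ^ 2) ^ p ≠ 0 := fun t _ => by positivity
    simp only [hF]
    exact (((continuousOn_const.mul ((continuousOn_const.add (continuousOn_const.mul
      (continuousOn_id.pow 2))).pow p |>.inv₀ hne'')).mul
      ((continuousOn_id.pow 2).div (continuousOn_id.pow (d + n)) hne')).div continuousOn_id hne)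
  -- pointwise bound on `(½ℓ, ½ℓL]`
  have hpt : ∀ t ∈ Ioc (ℓ / 2) (ℓ * L / 2), |latGrad l (wKer d s t) x / t| ≤ F t := by
    intro t ht
    have ht2 : 1 / 2 ≤ t := by linarith [ht.1]
    have ht0 : 0 < t := by linarith
    rw [abs_div, abs_of_pos ht0]
    exact div_le_div_of_nonneg_right (hw s hs hs1 t ht2 x) ht0.le
  have hint : IntegrableOn (fun t : ℝ => latGrad l (wKer d s t) x / t) (Ioc (ℓ / 2) (ℓ * L / 2)) :=
    (latGrad_setIntegral_wKer_div hs (by positivity) _ l x).1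
  have hFint : IntegrableOn F (Ioc (ℓ / 2) (ℓ * L / 2)) :=
    integrableOn_Ioc_of_continuousOn (hFcont _ _ (by positivity))
  have h1 := abs_setIntegral_le_of_abs_le measurableSet_Ioc hint hFint hpt
  -- rescale
  have e1 : ℓ / 2 = ℓ * (1 / 2) := by ring
  have e2 : ℓ * L / 2 = ℓ * (L / 2) := by ring
  have hscale : ∫ t in Ioc (ℓ / 2) (ℓ * L / 2), F t =
      c * (ℓ ^ 2 / ℓ ^ (d + n)) * ∫ τ in Ioc (1 / 2 : ℝ) (L / 2),
        ((1 + s * ℓ ^ 2 * τ ^ 2) ^ p)⁻¹ * (τ ^ 2 / τ ^ (d + n)) / τ := by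
    rw [e1, e2, setIntegral_Ioc_comp_mul hℓ0 (by linarith) F, ← integral_const_mul,
      ← integral_const_mul]
    refine setIntegral_congr_fun measurableSet_Ioc fun τ hτ => ?_
    have hτ0 : 0 < τ := by linarith [hτ.1]
    simp only [hF]
    have hP : (1 + s * (ℓ * τ) ^ 2) ^ p = (1 + s * ℓ ^ 2 * τ ^ 2) ^ p := by ring
    rw [hP, mul_pow, mul_pow]
    have hτd : τ ^ (d + n) ≠ 0 := (pow_pos hτ0 (d + n)).ne'
    have hℓd : ℓ ^ (d + n) ≠ 0 := (pow_pos hℓ0 (d + n)).ne'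
    have hτ' : τ ≠ 0 := hτ0.ne'
    have hℓ' : ℓ ≠ 0 := hℓ0.ne'
    field_simp
  rw [hscale] at h1
  exact h1

/-- **The regular part in the large-mass regime, with gradients**: if
`|∇^l w(t,x;s)| ≤ cs⁻¹t^{-2p}t^{2-d-n}` for `t ≥ ½`, `s ≥ 1` (Slade (10.8), third regime), then
for `ℓ ≥ 1`, `L ≥ 1`, `s ≥ 1`:
`|∫_{(½ℓ,½ℓL]} ∇^l w(t,x;s)dt/t| ≤ c s⁻¹ ℓ^{-2p}ℓ^{2-d-n} ∫_{(½,½L]} τ^{-2p}τ^{2-d-n} dτ/τ`.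
[cite: Slade2017, §10.1 (display (10.18): T_{j,3}, with ∇^a)] -/
theorem abs_regular_grad_le_of_large_mass {c : ℝ} {p n : ℕ} {l : List (Site d)}
    (hw : ∀ s : ℝ, 1 ≤ s → ∀ t : ℝ, 1 / 2 ≤ t → ∀ x : Site d,
      |latGrad l (wKer d s t) x| ≤ c * s⁻¹ * (t ^ (2 * p))⁻¹ * (t ^ 2 / t ^ (d + n)))
    {L : ℝ} (hL : 1 ≤ L) {ℓ : ℝ} (hℓ : 1 ≤ ℓ) {s : ℝ} (hs1 : 1 ≤ s) (x : Site d) :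
    |∫ t in Ioc (ℓ / 2) (ℓ * L / 2), latGrad l (wKer d s t) x / t| ≤
      c * s⁻¹ * ((ℓ ^ (2 * p))⁻¹ * (ℓ ^ 2 / ℓ ^ (d + n))) *
        ∫ τ in Ioc (1 / 2 : ℝ) (L / 2), (τ ^ (2 * p))⁻¹ * (τ ^ 2 / τ ^ (d + n)) / τ := by
  have hℓ0 : 0 < ℓ := by linarith
  have hs : 0 < s := by linarith
  set F : ℝ → ℝ := fun t => c * s⁻¹ * (t ^ (2 * p))⁻¹ * (t ^ 2 / t ^ (d + n)) / t with hF
  have hFcont : ∀ a b : ℝ, 0 < a → ContinuousOn F (Icc a b) := by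
    intro a b ha
    have hne : ∀ t ∈ Icc a b, t ≠ 0 := fun t ht => (lt_of_lt_of_le ha ht.1).ne'
    have hne' : ∀ t ∈ Icc a b, t ^ (d + n) ≠ 0 := fun t ht => pow_ne_zero (d + n) (hne t ht)
    have hne'' : ∀ t ∈ Icc a b, t ^ (2 * p) ≠ 0 := fun t ht => pow_ne_zero _ (hne t ht)
    simp only [hF]
    exact (((continuousOn_const.mul ((continuousOn_id.pow (2 * p)).inv₀ hne'')).mul
      ((continuousOn_id.pow 2).div (continuousOn_id.pow (d + n)) hne')).div continuousOn_id hne)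
  have hpt : ∀ t ∈ Ioc (ℓ / 2) (ℓ * L / 2), |latGrad l (wKer d s t) x / t| ≤ F t := by
    intro t ht
    have ht2 : 1 / 2 ≤ t := by linarith [ht.1]
    have ht0 : 0 < t := by linarith
    rw [abs_div, abs_of_pos ht0]
    exact div_le_div_of_nonneg_right (hw s hs1 t ht2 x) ht0.le
  have hint : IntegrableOn (fun t : ℝ => latGrad l (wKer d s t) x / t) (Ioc (ℓ / 2) (ℓ * L / 2)) :=
    (latGrad_setIntegral_wKer_div hs (by positivity) _ l x).1
  have hFint : IntegrableOn F (Ioc (ℓ / 2) (ℓ * L / 2)) :=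
    integrableOn_Ioc_of_continuousOn (hFcont _ _ (by positivity))
  have h1 := abs_setIntegral_le_of_abs_le measurableSet_Ioc hint hFint hpt
  have e1 : ℓ / 2 = ℓ * (1 / 2) := by ring
  have e2 : ℓ * L / 2 = ℓ * (L / 2) := by ring
  have hscale : ∫ t in Ioc (ℓ / 2) (ℓ * L / 2), F t =
      c * s⁻¹ * ((ℓ ^ (2 * p))⁻¹ * (ℓ ^ 2 / ℓ ^ (d + n))) *
        ∫ τ in Ioc (1 / 2 : ℝ) (L / 2), (τ ^ (2 * p))⁻¹ * (τ ^ 2 / τ ^ (d + n)) / τ := by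
    rw [e1, e2, setIntegral_Ioc_comp_mul hℓ0 (by linarith) F, ← integral_const_mul,
      ← integral_const_mul]
    refine setIntegral_congr_fun measurableSet_Ioc fun τ hτ => ?_
    have hτ0 : 0 < τ := by linarith [hτ.1]
    simp only [hF]
    rw [mul_pow, mul_pow, mul_pow]
    have hτd : τ ^ (d + n) ≠ 0 := (pow_pos hτ0 (d + n)).ne'
    have hℓd : ℓ ^ (d + n) ≠ 0 := (pow_pos hℓ0 (d + n)).ne'
    have hτp : τ ^ (2 * p) ≠ 0 := (pow_pos hτ0 _).ne'
    have hℓp : ℓ ^ (2 * p) ≠ 0 := (pow_pos hℓ0 _).ne'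
    have hτ' : τ ≠ 0 := hτ0.ne'
    have hℓ' : ℓ ≠ 0 := hℓ0.ne'
    field_simp
  rw [hscale] at h1
  exact h1

/-- The special term of (10.6), differentiated:
`|∫_{(0,½]} ∇^l w(t,x;s)dt/t| ≤ 2^n · ½|f̂(0)/2πc|/(2d+s)` (`|∇^l𝟙_{x=0}| ≤ 2^n`).
[cite: Slade2017, §10.1 (display (10.11), the special term S_0, with ∇^a applied)] -/
theorem abs_special_grad_le (s : ℝ) (l : List (Site d)) (x : Site d) :
    |∫ t in Ioc 0 (1 / 2), latGrad l (wKer d s t) x / t| ≤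
      2 ^ l.length * |(𝓕 (profile : ℝ → ℂ) 0).re / (2 * π * cProfile)| / 2 * |1 / (2 * d + s)| := by
  rw [setIntegral_latGrad_wKer_div_Ioc_of_le_one s (by norm_num) (by norm_num) l x]
  have hδ : ∀ y : Site d, |(if y = 0 then (1 : ℝ) else 0)| ≤ 1 := by
    intro y
    split_ifs <;> simp
  have hG := abs_latGrad_le l hδ x
  rw [abs_mul, abs_mul, abs_mul, abs_of_pos (by positivity : (0 : ℝ) < 1 / 2)]
  calc 1 / 2 * (|1 / (2 * d + s)| * |(𝓕 (profile : ℝ → ℂ) 0).re / (2 * π * cProfile)| *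
        |latGrad l (fun y : Site d => if y = 0 then (1 : ℝ) else 0) x|)
      ≤ 1 / 2 * (|1 / (2 * d + s)| * |(𝓕 (profile : ℝ → ℂ) 0).re / (2 * π * cProfile)| *
        (2 ^ l.length * 1)) := by gcongr
    _ = _ := by ring

set_option maxHeartbeats 1000000 in
/-- **Slade, Proposition 3.3.1 (3.9) = Proposition 10.1.1 (10.3) with discrete gradients `∇^a`
(no mass derivative), on `ℤ^d`, PROVED for the explicit [Baue13a]/BBS decomposition**: for
`d ≥ 1`, `n`, `α ∈ (0, 2∧d)` and `p' ≥ 0` there is `c > 0` — independent of `m², L, j, x` and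
of the list `l` of `n` unit steps — such that for all `L ≥ 2`, `m² ≥ 0`, `j ≥ 1`, `x ∈ ℤ^d`:
`∫₀^∞ |∇^lΓ_j(x)(s)| ρ^{(α/2)}(s,m²) ds ≤
c (L^{j-1})^{α-d-n} (1/(1+m⁴(L^{j-1})^{2α}) + 1/(1+m²(L^{j-1})^{p'}))`, i.e. Slade's
"`|∇^aC_{j;x,y}| ≤ cL^{-(d-α+|a|)(j-1)}(1/(1+m⁴L^{2α(j-1)}) + 1/(1+m²L^{p'(j-1)}))`" with the
absolute value inside the `s`-integral. Printed proof, followed exactly as for `a = 0`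
(`Slade2017_prop331_estimate_abs`), with (10.7)–(10.8) for `∇^a w` (the extra factor
`t^{-|a|}`) and `|∇^a𝟙_{x=0}| ≤ 2^{|a|}` in the special term.
[cite: Slade2017, Proposition 3.3.1 (display (3.9), general a)] [cite: Slade2017, §10.1 (Proposition 10.1.1, display (10.3); proof, displays (10.11)–(10.18))] -/
theorem Slade2017_prop331_grad_estimate_abs (hd : 1 ≤ d) (n : ℕ) {α : ℝ} (hα0 : 0 < α) (hα2 : α < 2)
    (hαd : α < d) {p' : ℝ} (hp' : 0 ≤ p') :
    ∃ c : ℝ, 0 < c ∧ ∀ l : List (Site d), l.length = n → (∀ e ∈ l, (∑ i, |((e i : ℤ) : ℝ)|) ≤ 1) →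
      ∀ L : ℝ, 2 ≤ L → ∀ m2 : ℝ, 0 ≤ m2 → ∀ j : ℕ, 1 ≤ j → ∀ x : Site d,
      ∫ s in Ioi 0, |latGrad l (Gam d L s j) x| * Kato.katoDensity (α / 2) m2 s ≤ c * (L ^ (j - 1)) ^ (α - d - n) *
        (1 / (1 + m2 ^ 2 * (L ^ (j - 1)) ^ (2 * α)) + 1 / (1 + m2 * (L ^ (j - 1)) ^ p')) := by
  -- parameters
  set β : ℝ := α / 2 with hβ
  have hβ0 : 0 < β := by positivity
  have hβ1 : β < 1 := by rw [hβ]; linarith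
  have hβd : 2 * β < d := by rw [hβ]; linarith
  have hβdn : 2 * β < ((d + n : ℕ) : ℝ) := by
    push_cast
    linarith [hβd, (Nat.cast_nonneg n : (0 : ℝ) ≤ n)]
  have hαβ : α = 2 * β := by rw [hβ]; ring
  -- Kato's density
  set cρ : ℝ := 2 * Real.sin (π * β) / (π * (1 + Real.cos (π * β))) with hcρ
  have hsin : 0 < Real.sin (π * β) := Real.sin_pos_of_pos_of_lt_pi (by positivity)
    (by nlinarith [Real.pi_pos])
  have hcos := Kato.one_add_cos_pos hβ0 hβ1
  have hcρ0 : 0 < cρ := by positivity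
  have hρ : ∀ {A s : ℝ}, 0 ≤ A → 0 < s →
      Kato.katoDensity (α / 2) A s ≤ cρ * (s ^ β / (s ^ β + A) ^ 2) := fun hA hs =>
    Kato.katoDensity_le_rpow_div_sq hβ0 hβ1 hA hs
  have hρ0 : ∀ {A s : ℝ}, 0 < s → 0 ≤ Kato.katoDensity (α / 2) A s := fun hs =>
    (Kato.katoDensity_pos hβ0 hβ1 _ hs).le
  -- the bounds (10.8) on `w`
  obtain ⟨c₁, hc₁, hw₁all⟩ := Slade2017_display108_grad_small_mass hd n 1
  obtain ⟨c₂, hc₂, hw₂all⟩ := Slade2017_display108_grad_small_mass hd n 2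
  obtain ⟨p₃, hp₃1, hp₃⟩ : ∃ p₃ : ℕ, 1 ≤ p₃ ∧ p' ≤ 2 * p₃ - 2 + α := by
    obtain ⟨n, hn⟩ := exists_nat_ge (p' / 2 + 1)
    refine ⟨n + 1, by omega, ?_⟩
    push_cast
    linarith
  obtain ⟨c₃, hc₃, hw₃all⟩ := Slade2017_display108_grad_large_mass hd n p₃
  -- the `t`-integrals over `J_1`
  obtain ⟨θ, K₁, hθ0, hθβ, hK₁, hJ₁⟩ := exists_setIntegral_J_one_le (d := d + n) (by omega) hβ0 hβ1 hβdn
  obtain ⟨K₂, hK₂, hJ₂⟩ := exists_setIntegral_J_sq_le (d := d + n) (by omega)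
  obtain ⟨K₃, hK₃, hJ₃⟩ := exists_setIntegral_J_pow_le (d := d + n) (by omega) hp₃1
  -- constants
  set κ : ℝ := 2 ^ n * |(𝓕 (profile : ℝ → ℂ) 0).re / (2 * π * cProfile)| with hκ
  have hκ0 : 0 ≤ κ := by positivity
  set M₁ : ℝ := c₁ * K₁ + κ / 2 with hM₁
  set M₂ : ℝ := c₂ * K₂ + κ / 2 with hM₂
  set M₃ : ℝ := c₃ * K₃ + κ / 2 with hM₃
  have hM₁0 : 0 < M₁ := by positivity
  have hM₂0 : 0 < M₂ := by positivity
  have hM₃0 : 0 < M₃ := by positivity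
  have he₁ : 0 < 1 - β - θ := by linarith
  have he₂ : 0 < 1 + β - θ := by linarith
  have he₃ : 0 < 1 - β := by linarith
  set a₁ : ℝ := M₁ * cρ * (1 / (1 - β - θ) + 1 / (1 + β - θ)) with ha₁
  set a₂ : ℝ := M₂ * cρ * (1 / (β + 1) + 1 / (1 - β)) with ha₂
  set a₃ : ℝ := M₃ * cρ / β with ha₃
  have ha₁0 : 0 < a₁ := by positivity
  have ha₂0 : 0 < a₂ := by positivity
  have ha₃0 : 0 < a₃ := by positivity
  refine ⟨2 * a₁ + 2 * a₂ + a₃, by positivity, fun l hl hl1 L hL m2 hm2 j hj x => ?_⟩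
  have hw₁ := hw₁all l hl hl1
  have hw₂ := hw₂all l hl hl1
  have hw₃ := hw₃all l hl hl1
  -- notation for this `L, m², j, x`
  have hL1 : (1 : ℝ) ≤ L := by linarith
  set A : ℝ := m2 with hA
  set ℓ : ℝ := L ^ (j - 1) with hℓ
  have hℓ1 : 1 ≤ ℓ := one_le_pow₀ hL1
  have hℓ0 : 0 < ℓ := by linarith
  have hℓj : j = 1 → ℓ = 1 := fun h => by rw [hℓ, h]; simp
  set T : ℝ := (ℓ ^ 2)⁻¹ with hT
  have hT0 : 0 < T := by positivity
  have hT1 : T ≤ 1 := inv_le_one_of_one_le₀ (one_le_pow₀ hℓ1)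
  set P : ℝ := ℓ ^ (α - d - n : ℝ) with hP
  have hP0 : 0 < P := Real.rpow_pos_of_pos hℓ0 _
  set Aj : ℝ := A * ℓ ^ α with hAj
  have hAj0 : 0 ≤ Aj := mul_nonneg hm2 (Real.rpow_nonneg hℓ0.le _)
  have hAj2 : Aj ^ 2 = A ^ 2 * ℓ ^ (2 * α) := by
    rw [hAj, mul_pow, ← Real.rpow_natCast (ℓ ^ α) 2, ← Real.rpow_mul hℓ0.le]
    push_cast
    ring_nf
  have hfinal : ∀ {X₁ X₂ X₃ : ℝ}, X₁ ≤ 2 * (a₁ * P) / (1 + Aj ^ 2) → X₂ ≤ 2 * (a₂ * P) / (1 + Aj ^ 2) →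
      X₃ ≤ a₃ * P * (1 / (1 + A * ℓ ^ p')) →
      X₁ + X₂ + X₃ ≤ (2 * a₁ + 2 * a₂ + a₃) * P *
        (1 / (1 + A ^ 2 * ℓ ^ (2 * α)) + 1 / (1 + A * ℓ ^ p')) := by
    intro X₁ X₂ X₃ h1 h2 h3
    rw [← hAj2]
    have hF1 : 0 ≤ 1 / (1 + Aj ^ 2) := by positivity
    have hF2 : 0 ≤ 1 / (1 + A * ℓ ^ p') := by
      have := Real.rpow_nonneg hℓ0.le p'
      positivity
    have e : (2 * a₁ + 2 * a₂ + a₃) * P * (1 / (1 + Aj ^ 2) + 1 / (1 + A * ℓ ^ p')) =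
        2 * (a₁ * P) / (1 + Aj ^ 2) + 2 * (a₂ * P) / (1 + Aj ^ 2) + a₃ * P * (1 / (1 + A * ℓ ^ p')) +
          ((2 * a₁ + 2 * a₂) * P * (1 / (1 + A * ℓ ^ p')) + a₃ * P * (1 / (1 + Aj ^ 2))) := by
      ring
    rw [e]
    have : 0 ≤ (2 * a₁ + 2 * a₂) * P * (1 / (1 + A * ℓ ^ p')) + a₃ * P * (1 / (1 + Aj ^ 2)) := by
      positivity
    linarith
  -- the integrand; make the abbreviations opaque (cheap definitional unfolding only via equations)
  set f : ℝ → ℝ := fun s => |latGrad l (Gam d L s j) x| * Kato.katoDensity (α / 2) m2 s with hf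
  clear_value f Aj P T ℓ a₁ a₂ a₃ M₁ M₂ M₃ κ cρ β
  show ∫ s in Ioi 0, f s ≤ _
  by_cases hint : IntegrableOn f (Ioi 0)
  swap
  · rw [integral_undef hint]
    have := Real.rpow_nonneg hℓ0.le p'
    have := Real.rpow_nonneg hℓ0.le (2 * α)
    positivity
  -- Step 1: `Γ_j = R + 𝟙_{j=1}S` (10.6), and pointwise bounds on `|Γ_j(s)|` in the three regimes
  have hGam : ∀ s : ℝ, 0 < s → latGrad l (Gam d L s j) x =
      (∫ t in Ioc (ℓ / 2) (ℓ * L / 2), latGrad l (wKer d s t) x / t) +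
        (if j = 1 then ∫ t in Ioc 0 (1 / 2), latGrad l (wKer d s t) x / t else 0) := fun s hs => by
    have := latGrad_Gam_eq_regular_add hL1 hs hj l x
    rwa [← hℓ] at this
  have hfac : 0 ≤ ℓ ^ 2 / ℓ ^ (d + n) := by positivity
  have hfac1 : j = 1 → ℓ ^ 2 / ℓ ^ (d + n) = 1 := fun h => by rw [hℓj h]; simp
  have hSle : ∀ s : ℝ, 0 < s → j = 1 →
      |∫ t in Ioc 0 (1 / 2), latGrad l (wKer d s t) x / t| ≤ κ / 2 * s⁻¹ ∧
      |∫ t in Ioc 0 (1 / 2), latGrad l (wKer d s t) x / t| ≤ κ / 2 := by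
    intro s hs _
    have h := abs_special_grad_le s l x
    rw [hl, ← hκ, abs_of_pos (by positivity : (0 : ℝ) < 1 / (2 * d + s))] at h
    have hd' : (1 : ℝ) ≤ d := by exact_mod_cast hd
    constructor
    · refine h.trans (mul_le_mul_of_nonneg_left ?_ (by positivity))
      rw [one_div]
      exact inv_anti₀ hs (by linarith)
    · refine h.trans (mul_le_of_le_one_right (by positivity) ?_)
      rw [div_le_one (by positivity)]
      linarith
  -- (i) `s ≤ T = L^{-2(j-1)}` (hence `sℓ² ≤ 1`): (10.8) with `p = 1`
  have hG1 : ∀ s : ℝ, 0 < s → s ≤ T →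
      |latGrad l (Gam d L s j) x| ≤ M₁ * (ℓ ^ 2 / ℓ ^ (d + n)) * (s * ℓ ^ 2) ^ (-θ) := by
    intro s hs hsT
    have hs1 : s ≤ 1 := hsT.trans hT1
    have hσ1 : s * ℓ ^ 2 ≤ 1 := by
      have := mul_le_mul_of_nonneg_right hsT (sq_nonneg ℓ)
      rwa [hT, inv_mul_cancel₀ (by positivity)] at this
    have hσ0 : 0 < s * ℓ ^ 2 := by positivity
    have hR := abs_regular_grad_le_of_small_mass hw₁ hL1 hℓ1 hs hs1 x
    have hJ := hJ₁ (s * ℓ ^ 2) hσ0 hσ1 L hL1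
    have hpow1 : 1 ≤ (s * ℓ ^ 2) ^ (-θ) :=
      Real.one_le_rpow_of_pos_of_le_one_of_nonpos hσ0 hσ1 (by linarith)
    have hSb : |(if j = 1 then ∫ t in Ioc 0 (1 / 2), latGrad l (wKer d s t) x / t else 0)| ≤
        κ / 2 * (ℓ ^ 2 / ℓ ^ (d + n)) * (s * ℓ ^ 2) ^ (-θ) := by
      rcases eq_or_ne j 1 with h1 | h1
      · rw [if_pos h1, hfac1 h1, mul_one]
        exact ((hSle s hs h1).2).trans (le_mul_of_one_le_right (by positivity) hpow1)
      · rw [if_neg h1, abs_zero]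
        positivity
    rw [hGam s hs]
    calc |(∫ t in Ioc (ℓ / 2) (ℓ * L / 2), latGrad l (wKer d s t) x / t) +
          (if j = 1 then ∫ t in Ioc 0 (1 / 2), latGrad l (wKer d s t) x / t else 0)|
        ≤ |∫ t in Ioc (ℓ / 2) (ℓ * L / 2), latGrad l (wKer d s t) x / t| +
          |(if j = 1 then ∫ t in Ioc 0 (1 / 2), latGrad l (wKer d s t) x / t else 0)| := abs_add_le _ _
      _ ≤ c₁ * (ℓ ^ 2 / ℓ ^ (d + n)) * (K₁ * (s * ℓ ^ 2) ^ (-θ)) +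
          κ / 2 * (ℓ ^ 2 / ℓ ^ (d + n)) * (s * ℓ ^ 2) ^ (-θ) := by
          refine add_le_add (hR.trans ?_) hSb
          refine mul_le_mul_of_nonneg_left ?_ (by positivity)
          exact hJ
      _ = M₁ * (ℓ ^ 2 / ℓ ^ (d + n)) * (s * ℓ ^ 2) ^ (-θ) := by rw [hM₁]; ring
  -- (ii) `s ≤ 1`: (10.8) with `p = 2`
  have hG2 : ∀ s : ℝ, 0 < s → s ≤ 1 →
      |latGrad l (Gam d L s j) x| ≤ M₂ * (ℓ ^ 2 / ℓ ^ (d + n)) * ((s * ℓ ^ 2) ^ 2)⁻¹ := by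
    intro s hs hs1
    have hσ0 : 0 < s * ℓ ^ 2 := by positivity
    have hR := abs_regular_grad_le_of_small_mass hw₂ hL1 hℓ1 hs hs1 x
    have hJ := hJ₂ (s * ℓ ^ 2) hσ0 L hL1
    have hSb : |(if j = 1 then ∫ t in Ioc 0 (1 / 2), latGrad l (wKer d s t) x / t else 0)| ≤
        κ / 2 * (ℓ ^ 2 / ℓ ^ (d + n)) * ((s * ℓ ^ 2) ^ 2)⁻¹ := by
      rcases eq_or_ne j 1 with h1 | h1
      · rw [if_pos h1, hfac1 h1, mul_one, hℓj h1]
        have hpow1 : 1 ≤ ((s * 1 ^ 2) ^ 2)⁻¹ := by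
          rw [one_pow, mul_one, one_le_inv₀ (by positivity)]
          exact pow_le_one₀ hs.le hs1
        exact ((hSle s hs h1).2).trans (le_mul_of_one_le_right (by positivity) hpow1)
      · rw [if_neg h1, abs_zero]
        positivity
    rw [hGam s hs]
    calc |(∫ t in Ioc (ℓ / 2) (ℓ * L / 2), latGrad l (wKer d s t) x / t) +
          (if j = 1 then ∫ t in Ioc 0 (1 / 2), latGrad l (wKer d s t) x / t else 0)|
        ≤ |∫ t in Ioc (ℓ / 2) (ℓ * L / 2), latGrad l (wKer d s t) x / t| +
          |(if j = 1 then ∫ t in Ioc 0 (1 / 2), latGrad l (wKer d s t) x / t else 0)| := abs_add_le _ _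
      _ ≤ c₂ * (ℓ ^ 2 / ℓ ^ (d + n)) * (K₂ * ((s * ℓ ^ 2) ^ 2)⁻¹) +
          κ / 2 * (ℓ ^ 2 / ℓ ^ (d + n)) * ((s * ℓ ^ 2) ^ 2)⁻¹ := by
          refine add_le_add (hR.trans ?_) hSb
          refine mul_le_mul_of_nonneg_left ?_ (by positivity)
          exact hJ
      _ = M₂ * (ℓ ^ 2 / ℓ ^ (d + n)) * ((s * ℓ ^ 2) ^ 2)⁻¹ := by rw [hM₂]; ring
  -- (iii) `s ≥ 1`: (10.8), third regime, with `2p₃ - 2 + α ≥ p'`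
  have hG3 : ∀ s : ℝ, 1 ≤ s →
      |latGrad l (Gam d L s j) x| ≤ M₃ * s⁻¹ * ((ℓ ^ (2 * p₃))⁻¹ * (ℓ ^ 2 / ℓ ^ (d + n))) := by
    intro s hs1
    have hs : 0 < s := by linarith
    have hR := abs_regular_grad_le_of_large_mass hw₃ hL1 hℓ1 hs1 x
    have hJ := hJ₃ L hL1
    have hfac3 : 0 ≤ (ℓ ^ (2 * p₃))⁻¹ * (ℓ ^ 2 / ℓ ^ (d + n)) := by positivity
    have hSb : |(if j = 1 then ∫ t in Ioc 0 (1 / 2), latGrad l (wKer d s t) x / t else 0)| ≤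
        κ / 2 * s⁻¹ * ((ℓ ^ (2 * p₃))⁻¹ * (ℓ ^ 2 / ℓ ^ (d + n))) := by
      rcases eq_or_ne j 1 with h1 | h1
      · rw [if_pos h1, hfac1 h1, mul_one, hℓj h1, one_pow, inv_one, mul_one]
        exact (hSle s hs h1).1
      · rw [if_neg h1, abs_zero]
        positivity
    rw [hGam s hs]
    calc |(∫ t in Ioc (ℓ / 2) (ℓ * L / 2), latGrad l (wKer d s t) x / t) +
          (if j = 1 then ∫ t in Ioc 0 (1 / 2), latGrad l (wKer d s t) x / t else 0)|
        ≤ |∫ t in Ioc (ℓ / 2) (ℓ * L / 2), latGrad l (wKer d s t) x / t| +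
          |(if j = 1 then ∫ t in Ioc 0 (1 / 2), latGrad l (wKer d s t) x / t else 0)| := abs_add_le _ _
      _ ≤ c₃ * s⁻¹ * ((ℓ ^ (2 * p₃))⁻¹ * (ℓ ^ 2 / ℓ ^ (d + n))) * K₃ +
          κ / 2 * s⁻¹ * ((ℓ ^ (2 * p₃))⁻¹ * (ℓ ^ 2 / ℓ ^ (d + n))) :=
          add_le_add (hR.trans (mul_le_mul_of_nonneg_left hJ (by positivity))) hSb
      _ = M₃ * s⁻¹ * ((ℓ ^ (2 * p₃))⁻¹ * (ℓ ^ 2 / ℓ ^ (d + n))) := by rw [hM₃]; ring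
  -- Step 2: `|f| = |Γ_j| ρ` and the Kato bound (10.9)
  have hf_abs : ∀ s : ℝ, 0 < s → |f s| = |latGrad l (Gam d L s j) x| * Kato.katoDensity (α / 2) m2 s :=
    fun s hs => by simp only [hf]; rw [abs_mul, abs_abs, abs_of_nonneg (hρ0 hs)]
  have hfg : ∀ {s G X e : ℝ}, 0 < s → 0 ≤ G → |latGrad l (Gam d L s j) x| ≤ G * X → X * s ^ β = s ^ e →
      |f s| ≤ G * cρ * (s ^ e / (s ^ β + A) ^ 2) := by
    intro s G X e hs hG hGX hX
    rw [hf_abs s hs]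
    have hX0 : 0 ≤ G * X := (abs_nonneg _).trans hGX
    calc |latGrad l (Gam d L s j) x| * Kato.katoDensity (α / 2) m2 s
        ≤ G * X * (cρ * (s ^ β / (s ^ β + A) ^ 2)) :=
          mul_le_mul hGX (hρ hm2 hs) (hρ0 hs) hX0
      _ = G * cρ * (X * s ^ β / (s ^ β + A) ^ 2) := by ring
      _ = G * cρ * (s ^ e / (s ^ β + A) ^ 2) := by rw [hX]
  -- power counting
  have hℓ2 : 0 < ℓ ^ 2 := by positivity
  have hP1 : ∀ e₁ e₂ : ℝ, 2 + 2 * e₁ - 2 * e₂ - ((d + n : ℕ) : ℝ) = α - d - n →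
      ℓ ^ 2 / ℓ ^ (d + n) * (ℓ ^ 2) ^ e₁ * ((ℓ ^ 2)⁻¹) ^ e₂ = P := by
    intro e₁ e₂ he
    rw [rpow_combine hℓ0, he, hP]
  have hℓ2α : ℓ ^ (-(2 * α)) = (ℓ ^ α)⁻¹ ^ 2 := by
    rw [Real.rpow_neg hℓ0.le, inv_pow, ← Real.rpow_natCast (ℓ ^ α) 2, ← Real.rpow_mul hℓ0.le]
    congr 1
    push_cast
    ring_nf
  have hP2 : ∀ e₁ e₂ : ℝ, 2 + 2 * e₁ - 2 * e₂ - ((d + n : ℕ) : ℝ) = α - d - n - 2 * α →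
      A⁻¹ ^ 2 * (ℓ ^ 2 / ℓ ^ (d + n) * (ℓ ^ 2) ^ e₁ * ((ℓ ^ 2)⁻¹) ^ e₂) = P * Aj⁻¹ ^ 2 := by
    intro e₁ e₂ he
    rw [rpow_combine hℓ0, he, sub_eq_add_neg (α - (d : ℝ) - n), Real.rpow_add hℓ0, hℓ2α, hAj,
      ← hP, mul_inv, mul_pow]
    ring
  -- piece 1: `(0, T]`, i.e. `T_{j,1}` (and `S_0` on `(0,T]` when `j = 1`)
  obtain ⟨G₁, hG₁⟩ : ∃ G : ℝ, G = M₁ * ((ℓ ^ 2 / ℓ ^ (d + n)) * (ℓ ^ 2) ^ (-θ)) := ⟨_, rfl⟩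
  have hG₁0 : 0 ≤ G₁ := by
    rw [hG₁]
    exact mul_nonneg hM₁0.le (mul_nonneg hfac (Real.rpow_nonneg hℓ2.le _))
  have hg1 : ∀ s ∈ Ioc (0 : ℝ) T, |f s| ≤ G₁ * cρ * (s ^ (β - θ) / (s ^ β + A) ^ 2) := by
    intro s hs
    refine hfg (X := s ^ (-θ)) hs.1 hG₁0 ?_ ?_
    · have := hG1 s hs.1 hs.2
      rw [Real.mul_rpow hs.1.le hℓ2.le] at this
      calc |latGrad l (Gam d L s j) x| ≤ M₁ * (ℓ ^ 2 / ℓ ^ (d + n)) * (s ^ (-θ) * (ℓ ^ 2) ^ (-θ)) := this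
        _ = G₁ * s ^ (-θ) := by rw [hG₁]; ring
    · rw [← Real.rpow_add hs.1]
      congr 1
      ring
  have hγ1 : -1 < β - θ - 2 * β := by linarith
  have hi1 := CovBound.integrableOn_rpow_div_sq_Ioc hγ1 hm2 hT0.le
  have hpiece1 : |∫ s in Ioc 0 T, f s| ≤ 2 * (a₁ * P) / (1 + Aj ^ 2) := by
    have hsub : Ioc (0 : ℝ) T ⊆ Ioi 0 := fun s hs => Set.mem_Ioi.2 hs.1
    have hgi : IntegrableOn (fun s : ℝ => G₁ * cρ * (s ^ (β - θ) / (s ^ β + A) ^ 2)) (Ioc 0 T) :=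
      hi1.const_mul (G₁ * cρ)
    have hb0 := abs_setIntegral_le_of_abs_le (f := f) measurableSet_Ioc (hint.mono_set hsub) hgi hg1
    have he0 : ∫ s in Ioc 0 T, G₁ * cρ * (s ^ (β - θ) / (s ^ β + A) ^ 2) =
        G₁ * cρ * ∫ s in Ioc 0 T, s ^ (β - θ) / (s ^ β + A) ^ 2 := integral_const_mul _ _
    have hb := hb0.trans_eq he0
    refine le_two_mul_div_one_add_sq (mul_nonneg ha₁0.le hP0.le) hAj0 ?_ ?_
    · have h1 := CovBound.setIntegral_rpow_div_sq_Ioc_le hγ1 hm2 hT0.le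
      have hv : G₁ * cρ * (T ^ (β - θ - 2 * β + 1) / (β - θ - 2 * β + 1)) =
          M₁ * cρ * (1 / (1 - β - θ)) * P := by
        have := hP1 (-θ) (β - θ - 2 * β + 1) (by rw [hαβ]; push_cast; ring)
        rw [hG₁, hT, ← this]
        have : β - θ - 2 * β + 1 = 1 - β - θ := by ring
        rw [this]
        ring
      calc |∫ s in Ioc 0 T, f s| ≤ G₁ * cρ * ∫ s in Ioc 0 T, s ^ (β - θ) / (s ^ β + A) ^ 2 := hb
        _ ≤ G₁ * cρ * (T ^ (β - θ - 2 * β + 1) / (β - θ - 2 * β + 1)) :=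
            mul_le_mul_of_nonneg_left h1 (mul_nonneg hG₁0 hcρ0.le)
        _ = M₁ * cρ * (1 / (1 - β - θ)) * P := hv
        _ ≤ a₁ * P := by
            refine mul_le_mul_of_nonneg_right ?_ hP0.le
            rw [ha₁]
            refine mul_le_mul_of_nonneg_left ?_ (mul_nonneg hM₁0.le hcρ0.le)
            have : 0 ≤ 1 / (1 + β - θ) := one_div_nonneg.2 he₂.le
            linarith
    · intro hAjpos
      have hA0 : 0 < A := by
        rcases hm2.lt_or_eq with h | h
        · exact h
        · exfalso
          rw [hAj, ← h, zero_mul] at hAjpos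
          exact lt_irrefl _ hAjpos
      have h1 := CovBound.setIntegral_rpow_div_sq_Ioc_le' (β := β) (γ := β - θ) (by linarith)
        hA0 hT0.le
      have hv : G₁ * cρ * (A⁻¹ ^ 2 * T ^ (β - θ + 1) / (β - θ + 1)) =
          M₁ * cρ * (1 / (1 + β - θ)) * (P * Aj⁻¹ ^ 2) := by
        have := hP2 (-θ) (β - θ + 1) (by rw [hαβ]; push_cast; ring)
        rw [hG₁, hT, ← this]
        have : β - θ + 1 = 1 + β - θ := by ring
        rw [this]
        ring
      calc |∫ s in Ioc 0 T, f s| ≤ G₁ * cρ * ∫ s in Ioc 0 T, s ^ (β - θ) / (s ^ β + A) ^ 2 := hb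
        _ ≤ G₁ * cρ * (A⁻¹ ^ 2 * T ^ (β - θ + 1) / (β - θ + 1)) :=
            mul_le_mul_of_nonneg_left h1 (mul_nonneg hG₁0 hcρ0.le)
        _ = M₁ * cρ * (1 / (1 + β - θ)) * (P * Aj⁻¹ ^ 2) := hv
        _ ≤ a₁ * (P * Aj⁻¹ ^ 2) := by
            refine mul_le_mul_of_nonneg_right ?_ (mul_nonneg hP0.le (sq_nonneg _))
            rw [ha₁]
            refine mul_le_mul_of_nonneg_left ?_ (mul_nonneg hM₁0.le hcρ0.le)
            have : 0 ≤ 1 / (1 - β - θ) := one_div_nonneg.2 he₁.le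
            linarith
        _ = a₁ * P * Aj⁻¹ ^ 2 := by ring
  -- piece 2: `(T, 1]`, i.e. `T_{j,2}` with `p = 2`
  obtain ⟨G₂, hG₂⟩ : ∃ G : ℝ, G = M₂ * ((ℓ ^ 2 / ℓ ^ (d + n)) * (ℓ ^ 2) ^ (-2 : ℝ)) := ⟨_, rfl⟩
  have hG₂0 : 0 ≤ G₂ := by
    rw [hG₂]
    exact mul_nonneg hM₂0.le (mul_nonneg hfac (Real.rpow_nonneg hℓ2.le _))
  have hg2 : ∀ s ∈ Ioc T 1, |f s| ≤ G₂ * cρ * (s ^ (β - 2) / (s ^ β + A) ^ 2) := by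
    intro s hs
    have hs0 : 0 < s := lt_trans hT0 hs.1
    refine hfg (X := (s ^ 2)⁻¹) hs0 hG₂0 ?_ ?_
    · have := hG2 s hs0 hs.2
      calc |latGrad l (Gam d L s j) x| ≤ M₂ * (ℓ ^ 2 / ℓ ^ (d + n)) * ((s * ℓ ^ 2) ^ 2)⁻¹ := this
        _ = G₂ * (s ^ 2)⁻¹ := by
            rw [hG₂, Real.rpow_neg hℓ2.le, Real.rpow_two, mul_pow, mul_inv]
            ring
    · rw [← Real.rpow_two, ← Real.rpow_neg hs0.le, ← Real.rpow_add hs0]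
      congr 1
      ring
  have hγ2 : β - 2 - 2 * β < -1 := by linarith
  have hi2 := CovBound.integrableOn_rpow_div_sq_Ioi hγ2 hm2 hT0
  have hnn2 : 0 ≤ᵐ[volume.restrict (Ioi T)] fun s : ℝ => s ^ (β - 2) / (s ^ β + A) ^ 2 := by
    refine (ae_restrict_iff' measurableSet_Ioi).2 (Eventually.of_forall fun s hs => ?_)
    have hs0 : (0 : ℝ) < s := lt_trans hT0 (Set.mem_Ioi.1 hs)
    exact div_nonneg (Real.rpow_nonneg hs0.le _) (sq_nonneg _)
  have hpiece2 : |∫ s in Ioc T 1, f s| ≤ 2 * (a₂ * P) / (1 + Aj ^ 2) := by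
    have hsub : Ioc T 1 ⊆ Ioi 0 := fun s hs => Set.mem_Ioi.2 (lt_trans hT0 hs.1)
    have hgi : IntegrableOn (fun s : ℝ => G₂ * cρ * (s ^ (β - 2) / (s ^ β + A) ^ 2)) (Ioc T 1) :=
      (hi2.mono_set Ioc_subset_Ioi_self).const_mul (G₂ * cρ)
    have hb0 := abs_setIntegral_le_of_abs_le (f := f) measurableSet_Ioc (hint.mono_set hsub) hgi hg2
    have he0 : ∫ s in Ioc T 1, G₂ * cρ * (s ^ (β - 2) / (s ^ β + A) ^ 2) =
        G₂ * cρ * ∫ s in Ioc T 1, s ^ (β - 2) / (s ^ β + A) ^ 2 := integral_const_mul _ _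
    have hb := hb0.trans_eq he0
    have hb' : |∫ s in Ioc T 1, f s| ≤ G₂ * cρ * ∫ s in Ioi T, s ^ (β - 2) / (s ^ β + A) ^ 2 :=
      hb.trans (mul_le_mul_of_nonneg_left (setIntegral_mono_set hi2 hnn2
        Ioc_subset_Ioi_self.eventuallyLE) (mul_nonneg hG₂0 hcρ0.le))
    refine le_two_mul_div_one_add_sq (mul_nonneg ha₂0.le hP0.le) hAj0 ?_ ?_
    · have h1 := CovBound.setIntegral_rpow_div_sq_Ioi_le hγ2 hm2 hT0
      have hv : G₂ * cρ * (T ^ (β - 2 - 2 * β + 1) / (2 * β - (β - 2) - 1)) =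
          M₂ * cρ * (1 / (β + 1)) * P := by
        have := hP1 (-2) (β - 2 - 2 * β + 1) (by rw [hαβ]; push_cast; ring)
        rw [hG₂, hT, ← this]
        have : 2 * β - (β - 2) - 1 = β + 1 := by ring
        rw [this]
        ring
      calc |∫ s in Ioc T 1, f s| ≤ G₂ * cρ * ∫ s in Ioi T, s ^ (β - 2) / (s ^ β + A) ^ 2 := hb'
        _ ≤ G₂ * cρ * (T ^ (β - 2 - 2 * β + 1) / (2 * β - (β - 2) - 1)) :=
            mul_le_mul_of_nonneg_left h1 (mul_nonneg hG₂0 hcρ0.le)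
        _ = M₂ * cρ * (1 / (β + 1)) * P := hv
        _ ≤ a₂ * P := by
            refine mul_le_mul_of_nonneg_right ?_ hP0.le
            rw [ha₂]
            refine mul_le_mul_of_nonneg_left ?_ (mul_nonneg hM₂0.le hcρ0.le)
            have : 0 ≤ 1 / (1 - β) := one_div_nonneg.2 he₃.le
            linarith
    · intro hAjpos
      have hA0 : 0 < A := by
        rcases hm2.lt_or_eq with h | h
        · exact h
        · exfalso
          rw [hAj, ← h, zero_mul] at hAjpos
          exact lt_irrefl _ hAjpos
      have h1 := CovBound.setIntegral_rpow_div_sq_Ioi_le' (β := β) (γ := β - 2) (by linarith)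
        hA0 hT0
      have hv : G₂ * cρ * (A⁻¹ ^ 2 * T ^ (β - 2 + 1) / (-(β - 2) - 1)) =
          M₂ * cρ * (1 / (1 - β)) * (P * Aj⁻¹ ^ 2) := by
        have := hP2 (-2) (β - 2 + 1) (by rw [hαβ]; push_cast; ring)
        rw [hG₂, hT, ← this]
        have : -(β - 2) - 1 = 1 - β := by ring
        rw [this]
        ring
      calc |∫ s in Ioc T 1, f s| ≤ G₂ * cρ * ∫ s in Ioi T, s ^ (β - 2) / (s ^ β + A) ^ 2 := hb'
        _ ≤ G₂ * cρ * (A⁻¹ ^ 2 * T ^ (β - 2 + 1) / (-(β - 2) - 1)) :=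
            mul_le_mul_of_nonneg_left h1 (mul_nonneg hG₂0 hcρ0.le)
        _ = M₂ * cρ * (1 / (1 - β)) * (P * Aj⁻¹ ^ 2) := hv
        _ ≤ a₂ * (P * Aj⁻¹ ^ 2) := by
            refine mul_le_mul_of_nonneg_right ?_ (mul_nonneg hP0.le (sq_nonneg _))
            rw [ha₂]
            refine mul_le_mul_of_nonneg_left ?_ (mul_nonneg hM₂0.le hcρ0.le)
            have : 0 ≤ 1 / (β + 1) := one_div_nonneg.2 (by linarith)
            linarith
        _ = a₂ * P * Aj⁻¹ ^ 2 := by ring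
  -- piece 3: `(1, ∞)`, i.e. `T_{j,3}` (and `S_0` on `(1,∞)` when `j = 1`)
  obtain ⟨G₃, hG₃⟩ : ∃ G : ℝ, G = M₃ * ((ℓ ^ (2 * p₃))⁻¹ * (ℓ ^ 2 / ℓ ^ (d + n))) := ⟨_, rfl⟩
  have hG₃0 : 0 ≤ G₃ := by
    rw [hG₃]
    exact mul_nonneg hM₃0.le (mul_nonneg (inv_nonneg.2 (pow_nonneg hℓ0.le _)) hfac)
  have hg3 : ∀ s ∈ Ioi (1 : ℝ), |f s| ≤ G₃ * cρ * (s ^ (β - 1) / (s ^ β + A) ^ 2) := by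
    intro s hs
    have hs1 : (1 : ℝ) ≤ s := le_of_lt (Set.mem_Ioi.1 hs)
    have hs0 : 0 < s := lt_of_lt_of_le zero_lt_one hs1
    refine hfg (X := s⁻¹) hs0 hG₃0 ?_ ?_
    · calc |latGrad l (Gam d L s j) x| ≤ M₃ * s⁻¹ * ((ℓ ^ (2 * p₃))⁻¹ * (ℓ ^ 2 / ℓ ^ (d + n))) := hG3 s hs1
        _ = G₃ * s⁻¹ := by rw [hG₃]; ring
    · rw [← Real.rpow_neg_one, ← Real.rpow_add hs0]
      congr 1
      ring
  have hγ3 : β - 1 - 2 * β < -1 := by linarith only [hβ0]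
  have hi3 := CovBound.integrableOn_rpow_div_sq_Ioi hγ3 hm2 zero_lt_one
  have hpiece3 : |∫ s in Ioi 1, f s| ≤ a₃ * P * (1 / (1 + A * ℓ ^ p')) := by
    have hsub : Ioi (1 : ℝ) ⊆ Ioi 0 := fun s hs => Set.mem_Ioi.2 (lt_trans zero_lt_one (Set.mem_Ioi.1 hs))
    have hgi : IntegrableOn (fun s : ℝ => G₃ * cρ * (s ^ (β - 1) / (s ^ β + A) ^ 2)) (Ioi 1) :=
      hi3.const_mul (G₃ * cρ)
    have hb0 := abs_setIntegral_le_of_abs_le (f := f) measurableSet_Ioi (hint.mono_set hsub) hgi hg3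
    have he0 : ∫ s in Ioi (1 : ℝ), G₃ * cρ * (s ^ (β - 1) / (s ^ β + A) ^ 2) =
        G₃ * cρ * (1 / (β * (1 + A))) := by
      rw [← CovBound.setIntegral_rpow_sub_one_div_sq_Ioi hβ0 hm2]
      exact integral_const_mul _ _
    have hb := hb0.trans_eq he0
    have hq := rpow_neg_div_one_add_le (q := 2 * p₃ - 2 + α) hℓ1 hp' hp₃ hm2
    have hv : G₃ * cρ * (1 / (β * (1 + A))) = a₃ * P * (ℓ ^ (-(2 * p₃ - 2 + α)) / (1 + A)) := by
      have hsp : ℓ ^ (2 - 2 * (p₃ : ℝ) - ((d + n : ℕ) : ℝ) : ℝ) = P * ℓ ^ (-(2 * p₃ - 2 + α)) := by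
        rw [hP, ← Real.rpow_add hℓ0]
        congr 1
        push_cast
        ring
      rw [hG₃, pow_inv_mul_sq_div_pow hℓ0 p₃, hsp, ha₃, ← div_div]
      ring
    calc |∫ s in Ioi 1, f s| ≤ G₃ * cρ * (1 / (β * (1 + A))) := hb
      _ = a₃ * P * (ℓ ^ (-(2 * p₃ - 2 + α)) / (1 + A)) := hv
      _ ≤ a₃ * P * (1 / (1 + A * ℓ ^ p')) := mul_le_mul_of_nonneg_left hq (mul_nonneg ha₃0.le hP0.le)
  -- Step 3: assemble
  rw [setIntegral_Ioi_eq_add_add hint hT0.le hT1]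
  calc (∫ s in Ioc 0 T, f s) + (∫ s in Ioc T 1, f s) + ∫ s in Ioi 1, f s
      ≤ |∫ s in Ioc 0 T, f s| + |∫ s in Ioc T 1, f s| + |∫ s in Ioi 1, f s| :=
        add_le_add_three (le_abs_self _) (le_abs_self _) (le_abs_self _)
    _ ≤ (2 * a₁ + 2 * a₂ + a₃) * P * (1 / (1 + A ^ 2 * ℓ ^ (2 * α)) + 1 / (1 + A * ℓ ^ p')) :=
        hfinal hpiece1 hpiece2 hpiece3

/-- **Slade, Proposition 3.3.1 (3.9) = Proposition 10.1.1 (10.3) with discrete gradients, on `ℤ^d`,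
in the printed form** (for `m² > 0`): `|∇^l_x C_{j;0,x}(m²)| ≤ c (L^{j-1})^{α-d-n}
(1/(1+m⁴(L^{j-1})^{2α}) + 1/(1+m²(L^{j-1})^{p'}))` for all unit-step lists `l` of length `n`,
`L ≥ 2`, `m² > 0`, `j ≥ 1`, `x`, with `c` independent of `m², L, j, x, l` (`∇^l` commutes with
the `s`-integral for `m² > 0`, `|∫∇^lΓ_jρ| ≤ ∫|∇^lΓ_j|ρ`, and `Slade2017_prop331_grad_estimate_abs`).
Scope: `m² = 0` is covered by the version with the absolute value inside the `s`-integral.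
[cite: Slade2017, Proposition 3.3.1 (display (3.9), general a)] [cite: Slade2017, §10.1 (Proposition 10.1.1, display (10.3))] -/
theorem Slade2017_prop331_grad_estimate (hd : 1 ≤ d) (n : ℕ) {α : ℝ} (hα0 : 0 < α) (hα2 : α < 2)
    (hαd : α < d) {p' : ℝ} (hp' : 0 ≤ p') :
    ∃ c : ℝ, 0 < c ∧ ∀ l : List (Site d), l.length = n → (∀ e ∈ l, (∑ i, |((e i : ℤ) : ℝ)|) ≤ 1) →
      ∀ L : ℝ, 2 ≤ L → ∀ m2 : ℝ, 0 < m2 → ∀ j : ℕ, 1 ≤ j → ∀ x : Site d,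
      |latGrad l (fracCov d L α m2 j) x| ≤ c * (L ^ (j - 1)) ^ (α - d - n) *
        (1 / (1 + m2 ^ 2 * (L ^ (j - 1)) ^ (2 * α)) + 1 / (1 + m2 * (L ^ (j - 1)) ^ p')) := by
  obtain ⟨c, hc, h⟩ := Slade2017_prop331_grad_estimate_abs hd n hα0 hα2 hαd hp'
  refine ⟨c, hc, fun l hl hl1 L hL m2 hm2 j hj x => le_trans ?_ (h l hl hl1 L hL m2 hm2.le j hj x)⟩
  have hβ0 : 0 < α / 2 := by positivity
  have hβ1 : α / 2 < 1 := by linarith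
  -- `∇^l` commutes with the `s`-integral
  set F : Site d → ℝ → ℝ := fun y s => Gam d L s j y * Kato.katoDensity (α / 2) m2 s with hF
  have hFi : ∀ y, Integrable (F y) ((volume : Measure ℝ).restrict (Ioi 0)) :=
    fun y => integrableOn_Gam_mul_katoDensity hd hβ0 hβ1 (by linarith) hm2 hj y
  obtain ⟨-, hcomm⟩ := latGrad_integral hFi l
  have hpt : ∀ s : ℝ, latGrad l (fun y => F y s) x =
      latGrad l (Gam d L s j) x * Kato.katoDensity (α / 2) m2 s := by
    intro s
    have e : (fun y => F y s) = fun y => Kato.katoDensity (α / 2) m2 s * Gam d L s j y := by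
      funext y
      simp only [hF]
      ring
    rw [e, latGrad_const_mul, mul_comm]
  have hC : fracCov d L α m2 j = fun y => ∫ s in Ioi 0, F y s := by
    funext y
    rfl
  rw [hC, hcomm x, integral_congr_ae (Eventually.of_forall hpt)]
  refine abs_integral_le_integral_abs.trans (le_of_eq (setIntegral_congr_fun measurableSet_Ioi
    fun s hs => ?_))
  rw [abs_mul, abs_of_nonneg (Kato.katoDensity_pos hβ0 hβ1 m2 hs).le]

/-! ### Continuity in the mass -/

/-- `∇^l` of a continuous family is continuous: if each `m² ↦ F(m²)(a)` is continuous then so is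
`m² ↦ ∇^l(F(m²))(x)`. [folklore] -/
theorem continuous_latGrad {F : ℝ → Site d → ℝ} (hF : ∀ a, Continuous fun m2 => F m2 a)
    (l : List (Site d)) : ∀ x, Continuous fun m2 => latGrad l (F m2) x := by
  induction l with
  | nil => intro x; simpa using hF x
  | cons e l ih =>
      intro x
      simp only [latGrad_cons]
      exact (ih (x + e)).sub (ih x)

/-- **`∇^l_x C_{j;0,x}(m²)` is continuous in `m²`** (Proposition 3.3.1: "`C_{j;x,y}` is continuous
in `m² ∈ [0,m̄²]`", here for the gradients as well, being finite signed sums of translates).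
[cite: Slade2017, Proposition 3.3.1 (continuity in m²)] -/
theorem continuous_latGrad_fracCov_mass (hd : 1 ≤ d) {α : ℝ} (hα0 : 0 < α) (hα2 : α < 2) {L : ℝ}
    (hL : 2 ≤ L) {j : ℕ} (hj : 1 ≤ j) (l : List (Site d)) (x : Site d) :
    Continuous fun m2 : ℝ => latGrad l (fracCov d L α m2 j) x :=
  continuous_latGrad (F := fun m2 a => fracCov d L α m2 j a)
    (fun a => continuous_fracCov_mass hd hα0 hα2 hL hj a) l x

end FRD

end LongRangePhi4

end Literature.Barriers.CriticalPhenomena
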